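import Mathlib.Algebra.Group.End
import Mathlib.Algebra.Group.Subgroup.Map
import Mathlib.GroupTheory.QuotientGroup.Defs
import Mathlib.GroupTheory.Subgroup.Center
import Mathlib.Topology.Algebra.Group.Basic
import Mathlib.FieldTheory.RatFunc.AsPolynomial
import Literature.IUT.HodgeTheaters.KappaCoricFunctions
import HarnessLib

/-!
# [IUTchI] Remark 3.1.7 (ii)–(iv), continued: `∞κ`-coric and `κ`-solvable elements of `L̄_C`, the
# subfield `L_C(κ-sol)`, and `κ-sol`-automorphisms of `Gal(L̄_C/L_C(κ-sol))`

S. Mochizuki, *Inter-universal Teichmüller theory I*, §3, Remark 3.1.7 (ii), (iii), (iv) (kurims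
final manuscript May 2020, pp. 67–69) [claim: Mochizuki2012, status: disputed]. Companion to
`KappaCoricFunctions.lean`, which types (i)–(iii) for RATIONAL functions `f ∈ L̄(t)`; in print the
`∞κ`-coric / `∞κ×`-coric / `κ`-solvable elements live in an ALGEBRAIC CLOSURE `L̄_C` of the function
field `L_C` ("an element `f ∈ L̄_C` is `∞κ`-coric if there exists a positive integer `n` such that
`fⁿ` is a `κ`-coric element of `L_C`"). This file types that general form over a field `Λ ⊇ Ω(t)`
(`Λ` standing for `L̄_C`, `Ω(t) = RatFunc Ω ⊇ L_C`), the subfield "`L_C(κ-sol) ⊆ L̄_C` generated by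
the `κ`-solvable elements" (iii), and the group theory of (iv): for the closed normal subgroup
`G = Gal(L̄_C/L_C(κ-sol))` of `Γ = Gal(L̄_C/L_C)`, "a *`κ-sol`-open subgroup* [is] the intersection
with `Gal(L̄_C/L_C(κ-sol))` of a normal open subgroup of `Gal(L̄_C/L_C)`", the subgroups
`Aut_{κ-sol}(G) ⊆ Aut(G)` "of automorphisms of the topological group … that preserve each
`κ-sol`-open subgroup", the induced `Aut_{κ-sol}(G) → Aut(Q)` for `Q = G/H`, `H` `κ-sol`-open
normal, and the final claim "`Gal(L̄_C/L_C(κ-sol))` is center-free" as a statement.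

Deliberately NOT here (need the function field of `C̲_K` and Galois theory of `L_C`): the subfield
`L_C(C̲_K)`, "`Gal(K/F(μ_l)) ⊆ Gal(K/F_mod)` is the unique subgroup isomorphic to `SL₂(𝔽_l)`", the
linear disjointness of `L_C(C̲_K)` and `F(μ_l)·L_C(κ-sol)` over `F(μ_l)·L_C` and the resulting
action ((iii)); `Out_{κ-sol}`, the profinite topologies on `Aut_{κ-sol}`/`Out_{κ-sol}` and the
cartesian diagram of (iv) beyond the center-freeness statement; the proof via [NodNon] Thm. C.
-/

namespace Literature.IUT.HodgeTheaters

open Polynomial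
open scoped RatFunc

universe u v

namespace CriticalLocus

variable {Ω : Type u} [Field Ω] [CharZero Ω]

/-- Rmk 3.1.7 (ii), general form: `f ∈ L̄_C` (here: `f ∈ Λ ⊇ Ω(t)`) is **`∞κ`-coric** if "there exists
a positive integer `n` such that `fⁿ` is a `κ`-coric element of `L_C`" (the image of a `κ`-coric
rational function). [claim: Mochizuki2012, status: disputed] -/
def IsInftyKappaCoricIn (S : CriticalLocus Ω) (Λ : Type v) [Field Λ] [Algebra (RatFunc Ω) Λ]
    (f : Λ) : Prop :=
  ∃ n : ℕ, 0 < n ∧ ∃ g : RatFunc Ω, S.IsKappaCoric g ∧ f ^ n = algebraMap (RatFunc Ω) Λ g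

/-- Rmk 3.1.7 (ii), general form: `f ∈ L̄_C` is **`∞κ×`-coric** if "there exists an element `c ∈ U_L`
such that `c·f` is `∞κ`-coric" (`U_L` the parameter `U ⊆ Ω`). [claim: Mochizuki2012, status: disputed] -/
def IsInftyKappaUnitCoricIn (S : CriticalLocus Ω) (Λ : Type v) [Field Λ]
    [Algebra (RatFunc Ω) Λ] (U : Set Ω) (f : Λ) : Prop :=
  ∃ c ∈ U, S.IsInftyKappaCoricIn Λ (algebraMap (RatFunc Ω) Λ (RatFunc.C c) * f)

/-- Rmk 3.1.7 (iii), general form (`L = F_mod`, `L̄ = F̄`): `f ∈ L̄_C` is **`κ`-solvable** if "it is an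
`F_sol^×`-multiple of an `∞κ`-coric element of `L̄_C`" (`F_sol^×` the parameter `Fsol ⊆ Ω`).
[claim: Mochizuki2012, status: disputed] -/
def IsKappaSolvableIn (S : CriticalLocus Ω) (Λ : Type v) [Field Λ] [Algebra (RatFunc Ω) Λ]
    (Fsol : Set Ω) (f : Λ) : Prop :=
  ∃ c ∈ Fsol, c ≠ 0 ∧ ∃ g : Λ, S.IsInftyKappaCoricIn Λ g ∧
    f = algebraMap (RatFunc Ω) Λ (RatFunc.C c) * g

/-- Rmk 3.1.7 (iii): "`L_C(κ-sol) ⊆ L̄_C`, the subfield of `L̄_C` generated by the `κ`-solvable elements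
of `L̄_C`". [claim: Mochizuki2012, status: disputed] -/
def kappaSolSubfield (S : CriticalLocus Ω) (Λ : Type v) [Field Λ] [Algebra (RatFunc Ω) Λ]
    (Fsol : Set Ω) : Subfield Λ :=
  Subfield.closure {f : Λ | S.IsKappaSolvableIn Λ Fsol f}

/-- Rmk 3.1.7 (iii): "an element `f ∈ L̄_C` is `κ`-solvable if and only if there exists a positive
integer `n` such that `fⁿ` is a `∞κ×`-coric element of `F_sol·L_C`" — typed as a statement
(for `f ∈ Λ`, with `U = F_sol^×`). [claim: Mochizuki2012, status: disputed] -/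
def KappaSolvableIff (S : CriticalLocus Ω) (Λ : Type v) [Field Λ] [Algebra (RatFunc Ω) Λ]
    (Fsol : Set Ω) (f : Λ) : Prop :=
  S.IsKappaSolvableIn Λ Fsol f ↔ ∃ n : ℕ, 0 < n ∧ S.IsInftyKappaUnitCoricIn Λ Fsol (f ^ n)

/-- A rational `f ∈ Ω(t)` that is `∞κ`-coric in the sense of `KappaCoricFunctions.lean` is
`∞κ`-coric in `Λ` — PROVED (the general notion extends the rational one).
[claim: Mochizuki2012, status: disputed] -/
theorem isInftyKappaCoricIn_of_isInftyKappaCoric (S : CriticalLocus Ω) (Λ : Type v) [Field Λ]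
    [Algebra (RatFunc Ω) Λ] (f : RatFunc Ω) (hf : S.IsInftyKappaCoric f) :
    S.IsInftyKappaCoricIn Λ (algebraMap (RatFunc Ω) Λ f) := by
  obtain ⟨n, hn, h⟩ := hf
  exact ⟨n, hn, f ^ n, h, by rw [map_pow]⟩

end CriticalLocus

/-! ### Remark 3.1.7 (iv): `κ-sol`-open subgroups and `κ-sol`-automorphisms -/

namespace KappaSolGalois

variable {Γ : Type u} [Group Γ] [TopologicalSpace Γ]

/-- Rmk 3.1.7 (iv): for `G = Gal(L̄_C/L_C(κ-sol)) ⊆ Γ = Gal(L̄_C/L_C)`, "a subgroup of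
`Gal(L̄_C/L_C(κ-sol))` [is] a *`κ-sol`-open subgroup* if it is the intersection with
`Gal(L̄_C/L_C(κ-sol))` of a normal open subgroup of `Gal(L̄_C/L_C)`" (typed for any subgroup `G`
of a topological group `Γ`). [claim: Mochizuki2012, status: disputed] -/
def IsKappaSolOpen (G : Subgroup Γ) (H : Subgroup G) : Prop :=
  ∃ N : Subgroup Γ, N.Normal ∧ IsOpen (N : Set Γ) ∧ H = N.subgroupOf G

/-- Rmk 3.1.7 (iv): "`Aut_{κ-sol}(Gal(L̄_C/L_C(κ-sol))) ⊆ Aut(Gal(L̄_C/L_C(κ-sol)))`, [the subgroup] of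
automorphisms of the topological group … that preserve each `κ-sol`-open subgroup — i.e., of
'`κ-sol`-automorphisms'". [claim: Mochizuki2012, status: disputed] -/
def autKappaSol (G : Subgroup Γ) : Subgroup (MulAut G) where
  carrier := {φ | Continuous φ ∧ Continuous φ.symm ∧
    ∀ H : Subgroup G, IsKappaSolOpen G H → H.map φ.toMonoidHom = H}
  mul_mem' := by
    rintro φ ψ ⟨hφ, hφ', hφH⟩ ⟨hψ, hψ', hψH⟩
    refine ⟨hφ.comp hψ, hψ'.comp hφ', fun H hH => ?_⟩
    have : (φ * ψ).toMonoidHom = φ.toMonoidHom.comp ψ.toMonoidHom := rfl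
    rw [this, ← Subgroup.map_map, hψH H hH, hφH H hH]
  one_mem' := ⟨continuous_id, continuous_id, fun H _ => Subgroup.map_id H⟩
  inv_mem' := by
    rintro φ ⟨hφ, hφ', hφH⟩
    refine ⟨hφ', hφ, fun H hH => ?_⟩
    conv_lhs => rw [← hφH H hH]
    rw [Subgroup.map_map]
    have : (φ⁻¹.toMonoidHom.comp φ.toMonoidHom) = MonoidHom.id G :=
      MonoidHom.ext fun x => φ.symm_apply_apply x
    rw [this, Subgroup.map_id]

/-- Rmk 3.1.7 (iv): "natural compatible homomorphisms `Aut_{κ-sol}(Gal(L̄_C/L_C(κ-sol))) → Aut(Q)` …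
for each quotient `Gal(L̄_C/L_C(κ-sol)) ↠ Q` by a `κ-sol`-open subgroup" — the automorphism of
`Q = G/H` induced by a `κ-sol`-automorphism (`H` normal in `G`, as an intersection with a normal
subgroup). [claim: Mochizuki2012, status: disputed] -/
def toAutQuotient (G : Subgroup Γ) (H : Subgroup G) [H.Normal] (φ : MulAut G)
    (hφ : H.map φ.toMonoidHom = H) :
    MulAut (G ⧸ H) :=
  QuotientGroup.congr H H φ hφ

/-- A `κ-sol`-open subgroup is normal in `G` (being cut out by a normal subgroup of `Γ`) — PROVED.
[claim: Mochizuki2012, status: disputed] -/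
theorem IsKappaSolOpen.normal (G : Subgroup Γ) {H : Subgroup G} (hH : IsKappaSolOpen G H) :
    H.Normal := by
  obtain ⟨N, hN, -, rfl⟩ := hH
  haveI := hN
  infer_instance

/-- Rmk 3.1.7 (iv), final display: "`Gal(L̄_C/L_C(κ-sol))` is center-free" (proved in print via
Lemma 2.7 (vi), (vii) and the Galois injectivity of [NodNon] Thm. C) — typed as a statement about
the (parameter) group `G`. [claim: Mochizuki2012, status: disputed] -/
def CenterFree (G : Subgroup Γ) : Prop := Subgroup.center G = ⊥

end KappaSolGalois

/-! ### Addendum (review, L5-lead ruling 2026-08-25): Rmk 3.1.7 (iii) restated with its closure hypotheses -/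

namespace CriticalLocus

variable {Ω : Type u} [Field Ω] [CharZero Ω]

/-- Rmk 3.1.7 (iii), RESTATED (the bare `KappaSolvableIff` quantifies over an ARBITRARY subset
`Fsol ⊆ Ω` and is false for e.g. `Fsol = {2}`, `f = 2` — kernel witness by abc-iut-L5-t12; print's
`F_sol^×` is the multiplicative group of the maximal SOLVABLE extension, hence closed under inverses,
powers and `n`-th roots): under these three closure hypotheses on `Fsol`, "an element `f ∈ L̄_C` is
`κ`-solvable if and only if there exists a positive integer `n` such that `fⁿ` is a `∞κ×`-coric
element of `F_sol·L_C`" (discharged by `kappaSolvableIff_of_rootClosed` in the companion proofs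
file). [claim: Mochizuki2012, status: disputed] -/
def KappaSolvableIffRootClosed (S : CriticalLocus Ω) (Λ : Type v) [Field Λ]
    [Algebra (RatFunc Ω) Λ] (Fsol : Set Ω) (f : Λ) : Prop :=
  (∀ c ∈ Fsol, c⁻¹ ∈ Fsol) → (∀ c ∈ Fsol, ∀ n : ℕ, c ^ n ∈ Fsol) →
    (∀ c ∈ Fsol, ∀ n : ℕ, 0 < n → ∃ d ∈ Fsol, d ^ n = c) → S.KappaSolvableIff Λ Fsol f

end CriticalLocus

end Literature.IUT.HodgeTheaters
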